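import Literature.RepresentationTheory.FiniteGroups.GLnUnipotent
import HarnessLib

/-!
# The anti-involution `ι(g) = J gᵀ J` of `GL_n(F)`

Topic `Literature/RepresentationTheory/FiniteGroups`.  `J` is the antidiagonal permutation matrix
(`i ↦ n-1-i`, `Fin.rev`), so `ι(g)_{ij} = g_{rev j, rev i}`.  This is the anti-automorphism used in
the Gelfand–Graev / Gelfand–Kazhdan proof of the uniqueness of Whittaker models (Bump, *Automorphic
Forms and Representations*, Thm. 4.1.2 for `n = 2`; Carter, *Finite Groups of Lie Type*, §8.1;
Steinberg, *Lectures on Chevalley Groups*, Thm. 49): it is an involution, reverses products,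
preserves the upper unitriangular group `U_n` and the non-degenerate character
`ψ_U(u) = ψ₀(∑ u_{i,i+1})` (`GLn.theta ψ₀ 1`).

* `GLn.iotaMatrix M = (M.submatrix rev rev)ᵀ`, `GLn.iota : GL_n(F) ≃ GL_n(F)`;
* `iota_mul : ι(gh) = ι(h) ι(g)`, `iota_iota`, `iota_one`, `iota_inv`;
* `iota_mem_unitUpper`, `theta_one_iota : θ_1(ι u) = θ_1(u)`.

## References

* D. Bump, *Automorphic Forms and Representations*, §4.1; R. W. Carter, *Finite Groups of Lie Type*,
  §8.1; R. Steinberg, *Lectures on Chevalley Groups*, §14 Thm. 49.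
-/

open scoped BigOperators Matrix

namespace Literature.RepresentationTheory.FiniteGroups.GLn

variable (F : Type*) [Field F] (n : ℕ)

/-- `ι(M)_{ij} = M_{rev j, rev i}`, i.e. `ι(M) = J Mᵀ J` with `J` the antidiagonal permutation matrix. [folklore] -/
def iotaMatrix (M : Matrix (Fin n) (Fin n) F) : Matrix (Fin n) (Fin n) F :=
  Matrix.of fun i j => M (Fin.rev j) (Fin.rev i)

omit [Field F] in
/-- Entries of `ι(M)`. [folklore] -/
@[simp] theorem iotaMatrix_apply (M : Matrix (Fin n) (Fin n) F) (i j : Fin n) :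
    iotaMatrix F n M i j = M (Fin.rev j) (Fin.rev i) := rfl

/-- `ι` reverses products: `ι(M N) = ι(N) ι(M)`. [folklore] -/
theorem iotaMatrix_mul (M N : Matrix (Fin n) (Fin n) F) :
    iotaMatrix F n (M * N) = iotaMatrix F n N * iotaMatrix F n M := by
  ext i j
  simp only [iotaMatrix_apply, Matrix.mul_apply]
  exact Fintype.sum_equiv Fin.revPerm _ _ fun l => by simp [mul_comm]

/-- `ι(1) = 1`. [folklore] -/
theorem iotaMatrix_one : iotaMatrix F n (1 : Matrix (Fin n) (Fin n) F) = 1 := by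
  ext i j
  simp only [iotaMatrix_apply, Matrix.one_apply, Fin.rev_inj, eq_comm]

omit [Field F] in
/-- `ι` is an involution on matrices. [folklore] -/
theorem iotaMatrix_iotaMatrix (M : Matrix (Fin n) (Fin n) F) : iotaMatrix F n (iotaMatrix F n M) = M := by
  ext i j; simp

/-- **The anti-involution `ι(g) = J gᵀ J` of `GL_n(F)`** as a bijection. [folklore] -/
def iota : GL (Fin n) F ≃ GL (Fin n) F where
  toFun g := ⟨iotaMatrix F n g.val, iotaMatrix F n (g⁻¹).val,
    by rw [← iotaMatrix_mul, ← Units.val_mul, inv_mul_cancel, Units.val_one, iotaMatrix_one],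
    by rw [← iotaMatrix_mul, ← Units.val_mul, mul_inv_cancel, Units.val_one, iotaMatrix_one]⟩
  invFun g := ⟨iotaMatrix F n g.val, iotaMatrix F n (g⁻¹).val,
    by rw [← iotaMatrix_mul, ← Units.val_mul, inv_mul_cancel, Units.val_one, iotaMatrix_one],
    by rw [← iotaMatrix_mul, ← Units.val_mul, mul_inv_cancel, Units.val_one, iotaMatrix_one]⟩
  left_inv g := Units.ext (iotaMatrix_iotaMatrix F n g.val)
  right_inv g := Units.ext (iotaMatrix_iotaMatrix F n g.val)

/-- Underlying matrix of `ι(g)`. [folklore] -/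
@[simp] theorem coe_iota (g : GL (Fin n) F) : (iota F n g).val = iotaMatrix F n g.val := rfl

/-- Entries of `ι(g)`. [folklore] -/
theorem iota_apply (g : GL (Fin n) F) (i j : Fin n) : (iota F n g).val i j = g.val (Fin.rev j) (Fin.rev i) := rfl

/-- `ι(gh) = ι(h) ι(g)`. [folklore] -/
theorem iota_mul (g h : GL (Fin n) F) : iota F n (g * h) = iota F n h * iota F n g :=
  Units.ext (by rw [coe_iota, Units.val_mul, iotaMatrix_mul, Units.val_mul, coe_iota, coe_iota])

/-- `ι(1) = 1`. [folklore] -/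
theorem iota_one : iota F n (1 : GL (Fin n) F) = 1 :=
  Units.ext (by rw [coe_iota, Units.val_one, iotaMatrix_one])

/-- `ι(ι(g)) = g`. [folklore] -/
theorem iota_iota (g : GL (Fin n) F) : iota F n (iota F n g) = g :=
  Units.ext (iotaMatrix_iotaMatrix F n g.val)

/-- `ι(g⁻¹) = ι(g)⁻¹`. [folklore] -/
theorem iota_inv (g : GL (Fin n) F) : iota F n g⁻¹ = (iota F n g)⁻¹ := by
  apply eq_inv_of_mul_eq_one_left
  rw [← iota_mul, mul_inv_cancel, iota_one]

/-- `ι` preserves the upper unitriangular group. [folklore] -/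
theorem iota_mem_unitUpper {g : GL (Fin n) F} (hg : g ∈ unitUpper F n) : iota F n g ∈ unitUpper F n := by
  refine ⟨fun i j hij => ?_, fun i => ?_⟩
  · rw [iota_apply]
    exact hg.1 _ _ (Fin.rev_lt_rev.mpr hij)
  · rw [iota_apply]
    exact hg.2 _

/-- `ι` preserves `U_n` (iff version). [folklore] -/
theorem iota_mem_unitUpper_iff {g : GL (Fin n) F} : iota F n g ∈ unitUpper F n ↔ g ∈ unitUpper F n :=
  ⟨fun h => by simpa [iota_iota] using iota_mem_unitUpper F n h, iota_mem_unitUpper F n⟩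

/-- The superdiagonal sum as a double sum. [folklore] -/
theorem superdiagSum_one_eq_sum_sum (M : Matrix (Fin n) (Fin n) F) :
    superdiagSum F n 1 M = ∑ i : Fin n, ∑ j : Fin n, if j.val = i.val + 1 then M i j else 0 := by
  unfold superdiagSum superdiag
  refine Finset.sum_congr rfl fun i _ => ?_
  rw [if_pos (by omega)]
  split_ifs with h
  · rw [Finset.sum_eq_single (⟨i.val + 1, h⟩ : Fin n)]
    · simp
    · intro j _ hj
      rw [if_neg]
      intro hj'
      exact hj (Fin.ext hj')
    · simp
  · refine (Finset.sum_eq_zero fun j _ => ?_).symm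
    rw [if_neg]
    intro hj
    have := j.2
    omega

/-- `ι` preserves the sum of the superdiagonal entries. [folklore] -/
theorem superdiagSum_one_iotaMatrix (M : Matrix (Fin n) (Fin n) F) :
    superdiagSum F n 1 (iotaMatrix F n M) = superdiagSum F n 1 M := by
  rw [superdiagSum_one_eq_sum_sum, superdiagSum_one_eq_sum_sum]
  simp only [iotaMatrix_apply]
  -- substitute `i ↦ rev i`, `j ↦ rev j`, then swap the sums
  rw [← Equiv.sum_comp Fin.revPerm]
  conv_lhs => arg 2; ext i; rw [← Equiv.sum_comp Fin.revPerm]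
  rw [Finset.sum_comm]
  refine Finset.sum_congr rfl fun a _ => Finset.sum_congr rfl fun b _ => ?_
  simp only [Fin.revPerm_apply, Fin.rev_rev, Fin.val_rev]
  have ha := a.2; have hb := b.2
  by_cases h : b.val = a.val + 1
  · rw [if_pos h, if_pos (by omega)]
  · rw [if_neg h, if_neg (by omega)]

variable {F n}

/-- **`ι` preserves the non-degenerate character**: `θ_1(ι u) = θ_1(u)`. [folklore] -/
theorem theta_one_iota (ψ₀ : AddChar F ℂ) (g : GL (Fin n) F) : theta ψ₀ 1 (iota F n g) = theta ψ₀ 1 g := by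
  rw [theta, theta, coe_iota, superdiagSum_one_iotaMatrix]

end Literature.RepresentationTheory.FiniteGroups.GLn
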